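import Literature.Barriers.CriticalPhenomena.RigorousRGSmallParameterHHWBleherSinai
import HarnessLib

/-!
# HHW Theorem 1.1 and the literal Theorem 2.1: the gap, the two routes around it, and where the tree stands (PROVED reductions)

Hara–Hattori–Watanabe, *Triviality of hierarchical Ising model in four dimensions*, Comm. Math.
Phys. 220 (2001) 13–40 (loci: PDF pages of the held published version). The tree vendors
Theorem 1.1 as `HaraHattoriWatanabe2001_thm11` and reduces it (`…HHWReduction`,
`HaraHattoriWatanabe2001_thm11_of_parts`) to the three named parts `_eqA1` (PROVED,
`…HHWNewman`), `_thm22` (reduced to Newman's (A.6) in `…HHWThm22`, (A.6) PROVED in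
`…HHWNewmanBoundsProofs`) and `_thm21` — Theorem 2.1 AS PRINTED, whose printed proof has a gap for
`N₀ < N₁` (review D-0026 of the split, 2026-08-15, source open):

* p. 14, proof of Theorem 2.1: "With assumptions of the theorem and by induction on `N`,
  Proposition 4.3 implies that for any `s` satisfying `s̲_{N₁} ≤ s ≤ s̄_{N₁}`, the bounds
  (4.9)–(4.11) hold for `N = N₁`" — Proposition 4.3 is applied at the levels `N₀ ≤ N < N₁`, where
  the theorem grants only (2.17) `μ_{2,N} < 2 + √2` (= (3.13)).
* p. 11, Proposition 4.3 is stated under "(3.13) and (4.9)–(4.11)"; its proof (pp. 12–13) runs on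
  (4.7) `1 < r_N < r*_N` and (4.8) `ζ_{*N} < ζ_N < ζ*_N` ("Rewriting (4.17), using (4.7) and (4.8),
  we have (4.22)"; "(3.16) is then bounded from above by `¼μ_{4,N}(1 - L₂(μ_{4,N}))`" uses
  `ζ_N ≤ ζ*_N = u(μ_{4,N})`), and p. 11 derives (4.7)–(4.8) from the critical mass condition
  (2.13) `1 ≤ μ_{2,N} ≤ 1 + (3/√2)μ_{4,N}`, not from (3.13).
* The constants leave no room to repair this inside the abstract implication: the propagation
  constants of (4.13) and (4.14), `(α₂/√2 + 4u(x))/L₂(x)²` and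
  `(α₃/2 + (12/√2)u(x)α₂ + 24u(x)²)/L₂(x)³`, equal `6.0689…` and `48.4689…` at `x = α₀ = 0.0045`
  against `α₂ = 6.07`, `α₃ = 48.469` (the `αᵢ` are the fixed points of the propagation), and both
  exceed `αᵢ` as soon as `ζ_N` is `0.3%` above `u(μ_{4,N})` — an excess
  `μ_{2,N} - 1 - (3/√2)μ_{4,N} ≈ 0.007`, which is the value of the `s₊`-trajectory at `N = 100`
  (p. 20: `μ_{2,100} = 1.01318…`, `μ_{4,100} = 0.00281…`). §5.3 (pp. 19–20) verifies
  `ā_{1,N} ≤ 1.6066` for `N ≤ 100` (stronger than (2.17)) and nothing of the kind of (2.13) at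
  the levels `70 ≤ N < 100`.

What §4 DOES prove is vendored and PROVED in the tree: `HaraHattoriWatanabe2001_thm21_corrected`
(Theorem 2.1 with `Thm21StripHypothesis N₀ N₁` = (2.13) at `N₀ ≤ N < N₁` on the window;
`…_corrected_holds`) and the original Bleher–Sinai form `N₀ = N₁`,
`HaraHattoriWatanabe2001_thm21_diag` (`…_diag_holds`), both in `…HHWBleherSinai`. The way around
the gap taken by the tree is **route S** (strip): the missing hypothesis for the paper's own levels,
`Thm21StripHypothesis 70 100`, is a finite computation of the kind of §5 and is CERTIFIED —
`Thm22Cert.strip_cert_ok` (`…HHWStripCert`: the enclosure recursion of Proposition 5.1 run from 15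
rational points bracketing `[s̲₁₀₀, s̄₁₀₀]`, pieces shrinking geometrically towards `s̄₁₀₀`, the
endpoint mixing (5.34) on each piece), made meaningful by `HierarchicalRG.thm21Strip_of_eqA6` and
assembled into `HaraHattoriWatanabe2001_thm11_of_thm21corrected_of_eqA6` (`…HHWStrip`),
`HaraHattoriWatanabe2001_thm11_of_thm22_of_strip` (`…HHWThm11OfStrip`) and the discharge
`HaraHattoriWatanabe2001_thm11_holds` (`…HHWThm11Holds`). In particular the instance
`(N₀, N₁) = (70, 100)` of the literal Theorem 2.1 — the only one the paper uses — is a theorem of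
the tree (`…_corrected_holds 70 100` with `HierarchicalRG.thm21Strip_70_100`); the universally
quantified literal statement `HaraHattoriWatanabe2001_thm21` stays what it is: the corrected
theorem plus an uncertified claim for every other pair `N₀ < N₁` (`…thm21_of_stripHypotheses`
below), needed by nothing.

This file (written during the D-0026 review of the split, concurrently with `…HHWStrip`) records
the elementary reductions behind both routes, with the whitelist axioms only:

* `HaraHattoriWatanabe2001_thm11_of_critical` — the last step (p. 6) packaged: any `s > 0` with
  `μ_{4,N} → 0`, `μ_{2,N} → 1` gives Theorem 1.1 (Lévy + `tendsto_charFun_traj` + `_eqA1_holds`;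
  cf. `HaraHattoriWatanabe2001_thm11_of_exists_critical` of `…HHWStrip`).
* `HaraHattoriWatanabe2001_thm11_of_diagHypothesis` — **route D (diagonal)**: Theorem 1.1 follows
  from `Thm21Hypothesis N₁ N₁` at ANY single level `N₁`, i.e. from the bounds (2.14)–(2.16) at level
  `N₁` for all `s ∈ [s̲_{N₁}, s̄_{N₁}]` (`s_c ≥ s̲_{N₁} > 0` by `sLow_pos_and_le_sUp`).
* `HaraHattoriWatanabe2001_thm11_of_hypotheses` — **route S (strip)** for a general pair
  `N₀ ≤ N₁`: Theorem 1.1 from `Thm21Hypothesis N₀ N₁` and `Thm21StripHypothesis N₀ N₁`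
  (cf. `HaraHattoriWatanabe2001_thm11_of_thm21corrected` of `…HHWStrip` at `(70, 100)`).
* `HaraHattoriWatanabe2001_thm21_of_stripHypotheses` — the literal `_thm21` is the corrected theorem
  plus the claim that (2.13) holds at the strip levels whenever the hypotheses of Theorem 2.1 do;
  nothing else is missing. `HierarchicalRG.one_le_mu2_of_sLow_le`: the lower half of (2.13) at the
  strip levels is free (Corollary 4.2); only `μ_{2,N} ≤ 1 + (3/√2)μ_{4,N}` carries content.

Orders of magnitude (NOT from the source; a floating-point run of the flow (3.5) truncated at `μ₁₆`,
which reproduces the printed `μ_{4,100} ≈ 0.0028` from `μ_{4,70} ≈ 0.0042` and the ratio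
`μ₆/μ₄² ≈ 3.7–3.8` of p. 20, cross-checking the certificate's design): the linearised flow is
`δ_{N+1} ≈ √2 δ_N - 3(1 - 1/√2)μ_{4,N}`, `δ = μ₂ - 1`, so the slope `3/√2` of (2.12) is exactly
its invariant direction; the critical trajectory runs INSIDE the strip (2.13), below the edge
`μ₂ = 1 + (3/√2)μ₄` by `≈ 27μ₄²` (`≈ 4.7·10⁻⁴` at `N = 70`, `≈ 2·10⁻⁴` at `N = 100`); on the
level-100 window the strip holds at the levels `70 ≤ N < 100` with margin shrinking from `≈ 4·10⁻³`
at `s̲₁₀₀` to `≈ 7·10⁻⁵` at `(s̄₁₀₀, N = 99)` (the certificate reports `≈ 6·10⁻⁵` there);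
perturbations of `s` grow by `≈ √2` per level, so the paper's two endpoints `10⁻¹⁶` apart
(`μ₂`-spread `0.017` at `N = 100`) could certify the strip only for `N ≲ 83` — hence the 15-point
grid with spacing down to `~10⁻¹⁹`. Route D, by contrast, is out of reach of endpoint mixing at any
single level: straddling the window needs a `μ₂`-spread `> (3/√2)μ_{4,N₁} ≈ 0.006`, while (2.16)
(`μ₈ ≈ 20μ₄³ ≈ 5·10⁻⁷`, a cancellation of `O(1)` Taylor coefficients `a₁, …, a₄`) tolerates
`≲ 3·10⁻⁷` of spread per piece — `~10⁴` pieces; this is the content of the Remark on p. 6 and the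
reason the paper (and the tree) take `N₀ = 70 < N₁ = 100`.

No new named fact is introduced (D-0026); the vendored `_thm21`, `_thm22`, `_thm11` are untouched.

## References

* T. Hara, T. Hattori, H. Watanabe, Comm. Math. Phys. 220 (2001) 13–40: Theorem 2.1 and Remark
  (pp. 5–6), Proposition 4.3 and (4.7)–(4.8) (p. 11), its proof (pp. 12–13), proof of Theorem 2.1
  (p. 14), §5.3 (pp. 19–20), proof of Theorem 1.1 (p. 6).
* H. Watanabe, *Triviality of hierarchical O(N) spin model in four dimensions with large N*,
  J. Stat. Phys. 115 (2004) (arXiv:hep-lat/0311005), §2, the weak-coupling proposition (labelled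
  `weak` in the source): the sequel states its Bleher–Sinai step in the single-level (`N₀ = N₁`)
  form, with all hypotheses at one level `n₁` on an interval `[α₋, α₊]`.
-/

noncomputable section

namespace Literature.Barriers.CriticalPhenomena

open _root_.MeasureTheory _root_.ProbabilityTheory _root_.Filter _root_.Set
open scoped _root_.Topology
open HierarchicalRG

/-- **The last step of Theorem 1.1 (p. 6), packaged**: a parameter `s > 0` along whose trajectory
`μ_{4,N} → 0` and `μ_{2,N} → 1` is a critical parameter in the sense of Theorem 1.1 — by Newman's
representation (A.1) (PROVED, `HaraHattoriWatanabe2001_eqA1_holds`), `ĥ_N(ξ) → e^{-ξ²}`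
(`tendsto_charFun_traj`), and Lévy's continuity theorem.
[cite: HaraHattoriWatanabe2001, §2.3 "Proof of Theorem 1.1" (p. 6)] -/
theorem HaraHattoriWatanabe2001_thm11_of_critical {s : ℝ} (hs : 0 < s)
    (h4 : Tendsto (fun N => mu4 (traj s N)) atTop (𝓝 0))
    (h2 : Tendsto (fun N => mu2 (traj s N)) atTop (𝓝 1)) : HaraHattoriWatanabe2001_thm11 := by
  refine ⟨s, hs, fun g => ?_⟩
  let μs : ℕ → ProbabilityMeasure ℝ := fun N => ⟨traj s N, inferInstance⟩
  let μ0 : ProbabilityMeasure ℝ := ⟨gaussianReal 0 2, inferInstance⟩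
  have hconv : Tendsto μs atTop (𝓝 μ0) := by
    apply ProbabilityMeasure.tendsto_of_tendsto_charFun
    intro t
    have h := tendsto_charFun_traj HaraHattoriWatanabe2001_eqA1_holds hs.le h2 h4 t
    have e : charFun (μ0 : Measure ℝ) t = ((Real.exp (-t ^ 2) : ℝ) : ℂ) := by
      change charFun (gaussianReal 0 2) t = _
      rw [charFun_gaussianReal]
      push_cast
      congr 1
      ring
    rw [e]
    exact h
  exact (ProbabilityMeasure.tendsto_iff_forall_integral_tendsto.1 hconv) g

/-- **Route D (the original Bleher–Sinai form, any single level).** If at some level `N₁` the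
bounds (2.14)–(2.16) hold for every `s` in the critical mass window `[s̲_{N₁}, s̄_{N₁}]`
(`Thm21Hypothesis N₁ N₁`; (2.17) is vacuous), then Theorem 1.1 holds: the PROVED diagonal case of
Theorem 2.1 (`HaraHattoriWatanabe2001_thm21_diag_holds`) gives `s_c ∈ [s̲_{N₁}, s̄_{N₁}]`, and
`s_c ≥ s̲_{N₁} > 0` (`sLow_pos_and_le_sUp`).
[cite: HaraHattoriWatanabe2001, Theorem 2.1, Remark (p. 6) and proof of Theorem 1.1 (p. 6)] -/
theorem HaraHattoriWatanabe2001_thm11_of_diagHypothesis {N₁ : ℕ} (h : Thm21Hypothesis N₁ N₁) :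
    HaraHattoriWatanabe2001_thm11 := by
  obtain ⟨s_c, ⟨hsc1, -⟩, h4, h2⟩ := HaraHattoriWatanabe2001_thm21_diag_holds N₁ h
  exact HaraHattoriWatanabe2001_thm11_of_critical ((sLow_pos_and_le_sUp N₁).1.trans_le hsc1) h4 h2

/-- **Route S (the corrected Theorem 2.1).** The hypotheses (2.14)–(2.17) of Theorem 2.1 for a pair
`N₀ ≤ N₁` together with the critical mass condition (2.13) at the levels `N₀ ≤ N < N₁` on the
window (`Thm21StripHypothesis`, the hypothesis the printed proof of Proposition 4.3 uses) give
Theorem 1.1, by `HaraHattoriWatanabe2001_thm21_corrected_holds`.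
[cite: HaraHattoriWatanabe2001, Theorem 2.1, §4 (pp. 10–14) and proof of Theorem 1.1 (p. 6)] -/
theorem HaraHattoriWatanabe2001_thm11_of_hypotheses {N₀ N₁ : ℕ} (h01 : N₀ ≤ N₁)
    (hyp : Thm21Hypothesis N₀ N₁) (hstrip : Thm21StripHypothesis N₀ N₁) :
    HaraHattoriWatanabe2001_thm11 := by
  obtain ⟨s_c, ⟨hsc1, -⟩, h4, h2⟩ :=
    HaraHattoriWatanabe2001_thm21_corrected_holds N₀ N₁ h01 hyp hstrip
  exact HaraHattoriWatanabe2001_thm11_of_critical ((sLow_pos_and_le_sUp N₁).1.trans_le hsc1) h4 h2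

/-- **What the literal `HaraHattoriWatanabe2001_thm21` amounts to, given the tree**: Theorem 2.1 as
printed follows from (indeed is equivalent, over `…_corrected_holds`, to the relevant instances of)
the claim that its hypotheses force the critical mass condition (2.13) at the strip levels
`N₀ ≤ N < N₁` on the window — the statement the printed proof takes for granted on p. 14.
[cite: HaraHattoriWatanabe2001, Theorem 2.1 and proof (p. 14)] -/
theorem HaraHattoriWatanabe2001_thm21_of_stripHypotheses
    (h : ∀ N₀ N₁ : ℕ, N₀ ≤ N₁ → Thm21Hypothesis N₀ N₁ → Thm21StripHypothesis N₀ N₁) :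
    HaraHattoriWatanabe2001_thm21 :=
  fun N₀ N₁ h01 hyp => HaraHattoriWatanabe2001_thm21_corrected_holds N₀ N₁ h01 hyp (h N₀ N₁ h01 hyp)

/-- The lower half of (2.13) at the strip levels is free: for `N ≤ N₁` and `s ≥ s̲_{N₁}`,
`μ_{2,N}(s) ≥ 1` (Corollary 4.2 iterated, `s̲_N ≤ s̲_{N₁}`, monotonicity of `μ_{2,N}` in `s` and
`μ_{2,N}(s̲_N) ≥ 1`). Only the upper half `μ_{2,N} ≤ 1 + (3/√2)μ_{4,N}` is missing.
[cite: HaraHattoriWatanabe2001, Corollary 4.2 and §2.3 (p. 5)] -/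
theorem HierarchicalRG.one_le_mu2_of_sLow_le {N N₁ : ℕ} (hN : N ≤ N₁) {s : ℝ} (hs : sLow N₁ ≤ s) :
    1 ≤ mu2 (traj s N) := by
  have hmono' : ∀ M, N ≤ M → sLow N ≤ sLow M := by
    intro M hM
    induction M, hM using Nat.le_induction with
    | base => exact le_rfl
    | succ M _ ih => exact ih.trans (sLow_le_sLow_succ M)
  have hmono : sLow N ≤ sLow N₁ := hmono' N₁ hN
  have hpos : 0 < sLow N := (sLow_pos_and_le_sUp N).1
  exact (mu2_sLow_ge N).trans
    (mu2_traj_mono N hpos.le (hpos.le.trans (hmono.trans hs)) (hmono.trans hs))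

end Literature.Barriers.CriticalPhenomena

end
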